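import Summits.Schanuel.Schanuel.Theorems.RoySmallValueDirichletGap.Negative.DirichletEdgeBoxLemmas

/-!
# Thue–Siegel non-vacuity of the crux `RoySmallValueDirichletGap` at the rational points `(0, p/q)`
(support lemma for crux `stmt-Schanuel-1050`)

Roy 2013 (arXiv:1301.0663), p. 3: "the hypotheses of the theorem are fulfilled by any algebraic point
`(ξ,η) ∈ ℚ̄ × ℚ̄*` because … an application of Thue–Siegel's lemma shows that, for any sufficiently
large `D`, there exists a non-zero `P ∈ ℤ[X₁,X₂]` of degree `≤ D` and norm `≤ exp(D^β)` such that
`𝒟₁ⁱP(ξ,η) = 0` for `0 ≤ i < 3⌊D^τ⌋`" (for `0 ≤ τ < 2`, `β > max{0, 2τ − 2}`).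

We kernel-check this at the points `(0, p/q)`, `p, q ∈ ℤ ∖ {0}` (which is what the `∃ᶠ`-refutation
of the crux needs): Siegel's lemma (Mathlib) on the integer `𝒟₁`-Taylor matrix at `(0, 1)` of the
tree (`taylorMatrix`, `RoyCriterionProofs.lean`) gives `Q = ∑ t_{ab} X₁ᵃX₂ᵇ ≠ 0` with
`𝒟₁ⁿQ(0,1) = 0` (`n < 3⌊D^τ⌋`) and `‖t‖ ≤ exp(D^β/2)`; the rescaled
`P = ∑ t_{ab} p^{H−b} qᵇ X₁ᵃX₂ᵇ` satisfies `P(z, (p/q)e^z) = p^H Q(z, e^z)`, hence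
`𝒟₁ⁿP(0, p/q) = 0`, and has height `≤ ‖t‖ max(|p|,|q|)^H ≤ exp(D^β)` for large `D`.
Everything is proved; no definitions, no named facts.
-/

noncomputable section

namespace Summit.Schanuel.Schanuel.Theorems.RoySmallValueDirichletGapThueSiegel

open MvPolynomial Filter Complex Finset Metric
open Literature.NumberTheory.Transcendental
open Literature.NumberTheory.Transcendental.Roy2013 (expEval2 iteratedDeriv_expEval2_zero)
open Summit.Schanuel.Schanuel.Theorems.RoySmallValueDirichletGapDirichlet (eventually_nat_rpow_le
  eventually_nat_rpow_log_le)

/-! ### Values of `𝒟₁ⁿ` at `(0, y)` through the `(0, 1)` Taylor functionals -/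

/-- `X₁ᵃX₂ᵇ(0 + z, y e^z) = yᵇ · X₁ᵃX₂ᵇ(z, e^z)`. [folklore] -/
theorem expEval2_monoXY_zero (a b : ℕ) (y z : ℂ) :
    expEval2 (monoXY a b) 0 y z = y ^ b * expEval (monoXY a b) z := by
  simp only [expEval2, expEval, monoXY, map_mul, map_pow, aeval_X, Matrix.cons_val_zero,
    Matrix.cons_val_one, zero_add, mul_pow]
  ring

/-- **`𝒟₁ⁿ(X₁ᵃX₂ᵇ)(0, y) = yᵇ · 𝒟₁ⁿ(X₁ᵃX₂ᵇ)(0, 1)`**. [folklore] -/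
theorem aeval_zero_iterate_royD_monoXY (n a b : ℕ) (y : ℂ) :
    aeval ![0, y] (royD^[n] (monoXY a b)) = y ^ b * (taylorInt n (monoXY a b) : ℂ) := by
  rw [← iteratedDeriv_expEval2_zero, taylorInt_cast]
  have h : expEval2 (monoXY a b) 0 y = fun z => y ^ b * expEval (monoXY a b) z :=
    funext (expEval2_monoXY_zero a b y)
  rw [h, iteratedDeriv_const_mul_field]

/-- Values of `𝒟₁ⁿ` of a box polynomial at `(0, y)`. [folklore] -/
theorem aeval_zero_iterate_royD_polyOfCoeffs {H : ℕ} (t : Fin (H + 1) × Fin (H + 1) → ℤ) (n : ℕ)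
    (y : ℂ) :
    aeval ![0, y] (royD^[n] (polyOfCoeffs t)) =
      ∑ ab, (t ab : ℂ) * (y ^ (ab.2 : ℕ) * (taylorInt n (monoXY ab.1 ab.2) : ℂ)) := by
  unfold polyOfCoeffs
  rw [iterate_royD_sum, map_sum]
  refine Finset.sum_congr rfl fun ab _ => ?_
  rw [iterate_royD_C_mul, map_mul, aeval_C, aeval_zero_iterate_royD_monoXY]
  simp

/-! ### Rescaling from `(0, 1)` to `(0, p/q)` -/

/-- **`𝒟₁ⁿP(0, p/q) = p^H · 𝒟₁ⁿQ(0, 1)`** for `P = ∑ t_{ab} p^{H−b} qᵇ X₁ᵃX₂ᵇ`,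
`Q = ∑ t_{ab} X₁ᵃX₂ᵇ`. [folklore] -/
theorem aeval_rescaled {H : ℕ} (t : Fin (H + 1) × Fin (H + 1) → ℤ) (p q : ℤ) (hq : q ≠ 0) (n : ℕ) :
    aeval ![0, ((p : ℂ) / (q : ℂ))]
      (royD^[n] (polyOfCoeffs fun ab => t ab * p ^ (H - (ab.2 : ℕ)) * q ^ (ab.2 : ℕ))) =
      (p : ℂ) ^ H * (taylorInt n (polyOfCoeffs t) : ℂ) := by
  rw [aeval_zero_iterate_royD_polyOfCoeffs, taylorInt_polyOfCoeffs]
  push_cast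
  rw [Finset.mul_sum]
  refine Finset.sum_congr rfl fun ab _ => ?_
  have hb : (ab.2 : ℕ) ≤ H := Nat.lt_succ_iff.1 ab.2.isLt
  have hq' : (q : ℂ) ≠ 0 := by exact_mod_cast hq
  have h1 : (q : ℂ) ^ (ab.2 : ℕ) * ((p : ℂ) / (q : ℂ)) ^ (ab.2 : ℕ) = (p : ℂ) ^ (ab.2 : ℕ) := by
    rw [← mul_pow, mul_div_cancel₀ _ hq']
  calc (t ab : ℂ) * (p : ℂ) ^ (H - (ab.2 : ℕ)) * (q : ℂ) ^ (ab.2 : ℕ) *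
        (((p : ℂ) / (q : ℂ)) ^ (ab.2 : ℕ) * (taylorInt n (monoXY ab.1 ab.2) : ℂ))
      = (t ab : ℂ) * ((p : ℂ) ^ (H - (ab.2 : ℕ)) * ((q : ℂ) ^ (ab.2 : ℕ) * ((p : ℂ) / (q : ℂ)) ^ (ab.2 : ℕ))) *
          (taylorInt n (monoXY ab.1 ab.2) : ℂ) := by ring
    _ = (p : ℂ) ^ H * ((taylorInt n (monoXY ab.1 ab.2) : ℂ) * (t ab : ℂ)) := by
        rw [h1, pow_sub_mul_pow _ hb]; ring

/-- The rescaled vector is non-zero. [folklore] -/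
theorem rescaled_ne_zero {H : ℕ} {t : Fin (H + 1) × Fin (H + 1) → ℤ} (ht : t ≠ 0) {p q : ℤ}
    (hp : p ≠ 0) (hq : q ≠ 0) :
    (fun ab : Fin (H + 1) × Fin (H + 1) => t ab * p ^ (H - (ab.2 : ℕ)) * q ^ (ab.2 : ℕ)) ≠ 0 := by
  obtain ⟨ab, hab⟩ := Function.ne_iff.1 ht
  refine Function.ne_iff.2 ⟨ab, ?_⟩
  simp only [Pi.zero_apply, ne_eq, mul_eq_zero, pow_eq_zero_iff', not_or]
  exact ⟨⟨hab, fun h => hp h.1⟩, fun h => hq h.1⟩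

/-- The rescaled vector has sup norm `≤ ‖t‖ · max(|p|,|q|)^H`. [folklore] -/
theorem norm_rescaled_le {H : ℕ} (t : Fin (H + 1) × Fin (H + 1) → ℤ) (p q : ℤ) :
    ‖(fun ab : Fin (H + 1) × Fin (H + 1) => t ab * p ^ (H - (ab.2 : ℕ)) * q ^ (ab.2 : ℕ))‖ ≤
      ‖t‖ * (max |(p : ℝ)| |(q : ℝ)|) ^ H := by
  refine (pi_norm_le_iff_of_nonneg (by positivity)).2 fun ab => ?_
  have hb : (ab.2 : ℕ) ≤ H := Nat.lt_succ_iff.1 ab.2.isLt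
  rw [Int.norm_eq_abs]
  push_cast
  rw [abs_mul, abs_mul, abs_pow, abs_pow]
  have h1 : |(t ab : ℝ)| ≤ ‖t‖ := by have := norm_le_pi_norm t ab; rwa [Int.norm_eq_abs] at this
  have h2 : |(p : ℝ)| ^ (H - (ab.2 : ℕ)) ≤ (max |(p : ℝ)| |(q : ℝ)|) ^ (H - (ab.2 : ℕ)) :=
    pow_le_pow_left₀ (abs_nonneg _) (le_max_left _ _) _
  have h3 : |(q : ℝ)| ^ (ab.2 : ℕ) ≤ (max |(p : ℝ)| |(q : ℝ)|) ^ (ab.2 : ℕ) :=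
    pow_le_pow_left₀ (abs_nonneg _) (le_max_right _ _) _
  calc |(t ab : ℝ)| * |(p : ℝ)| ^ (H - (ab.2 : ℕ)) * |(q : ℝ)| ^ (ab.2 : ℕ)
      ≤ ‖t‖ * (max |(p : ℝ)| |(q : ℝ)|) ^ (H - (ab.2 : ℕ)) * (max |(p : ℝ)| |(q : ℝ)|) ^ (ab.2 : ℕ) := by
        gcongr
    _ = ‖t‖ * (max |(p : ℝ)| |(q : ℝ)|) ^ H := by rw [mul_assoc, pow_sub_mul_pow _ hb]

/-- Total degree of a box polynomial on `{0..H}²` is `≤ 2H`. [folklore] -/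
theorem totalDegree_polyOfCoeffs_le {H : ℕ} (t : Fin (H + 1) × Fin (H + 1) → ℤ) :
    (polyOfCoeffs t).totalDegree ≤ 2 * H := by
  rw [polyOfCoeffs_eq_sum_monomial]
  refine totalDegree_finsetSum_le fun ab _ => (totalDegree_monomial_le _ _).trans ?_
  rw [boxExp, Finsupp.sum_add_index' (fun _ => rfl) (fun _ _ _ => rfl), Finsupp.sum_single_index rfl,
    Finsupp.sum_single_index rfl]
  show (ab.1 : ℕ) + (ab.2 : ℕ) ≤ 2 * H
  have := ab.1.is_lt; have := ab.2.is_lt; omega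

/-! ### Siegel's lemma on the Taylor matrix at `(0, 1)` -/

set_option maxHeartbeats 400000 in
/-- **Thue–Siegel at `(0, 1)`**: for `0 ≤ τ < 2` and `β > max{τ − 1, 2τ − 2}`, for all
large `D` there is a non-zero integer vector `t` on the box `{0..⌊D/2⌋}²` with
`𝒟₁ⁿ(∑ t_{ab}X₁ᵃX₂ᵇ)(0, 1) = 0` for all `n < 3⌊D^τ⌋` and `‖t‖ ≤ exp(D^β/2)`.
[cite: Roy2013, p. 3 (Thue–Siegel's lemma)] -/
theorem exists_taylor_kernel {τ β : ℝ} (hτ0 : 0 ≤ τ) (hτ2 : τ < 2) (hβ1 : τ - 1 < β)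
    (hβ2 : 2 * τ - 2 < β) :
    ∀ᶠ D : ℕ in atTop, ∃ t : Fin (D / 2 + 1) × Fin (D / 2 + 1) → ℤ, t ≠ 0 ∧
      (∀ n : ℕ, n < 3 * ⌊(D : ℝ) ^ τ⌋₊ → taylorInt n (polyOfCoeffs t) = 0) ∧
      ‖t‖ ≤ Real.exp ((D : ℝ) ^ β / 2) := by
  have hE : (0 : ℝ) < 1 / 6 := by norm_num
  have hev := (((eventually_nat_rpow_le 60 hβ1 hE).and
    (eventually_nat_rpow_le (72 * Real.log 3) hβ2 hE)).and
    (eventually_nat_rpow_log_le hβ2 (show (0 : ℝ) ≤ 72 * τ by positivity) hE)).and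
    (eventually_nat_rpow_le 24 hτ2 (show (0 : ℝ) < 1 by norm_num))
  filter_upwards [hev, eventually_ge_atTop 1] with D hD hD1
  obtain ⟨⟨⟨e1, e2⟩, e3⟩, e4⟩ := hD
  have hD1r : (1 : ℝ) ≤ D := by exact_mod_cast hD1
  have hD0r : (0 : ℝ) < D := by linarith
  set x : ℝ := (D : ℝ) with hx
  set H : ℕ := D / 2 with hH
  set L : ℕ := 3 * ⌊x ^ τ⌋₊ with hL
  -- sizes
  have hxτ1 : 1 ≤ x ^ τ := Real.one_le_rpow hD1r hτ0
  have hL1 : 1 ≤ L := by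
    have : 1 ≤ ⌊x ^ τ⌋₊ := Nat.le_floor (by simpa using hxτ1)
    omega
  have hLx : (L : ℝ) ≤ 3 * x ^ τ := by
    rw [hL]; push_cast
    exact mul_le_mul_of_nonneg_left (Nat.floor_le (by positivity)) (by norm_num)
  have hL0 : (0 : ℝ) < L := by exact_mod_cast hL1
  have hHx : (H : ℝ) ≤ x / 2 := by
    rw [hx, le_div_iff₀ (by norm_num : (0:ℝ) < 2)]; exact_mod_cast (show H * 2 ≤ D by omega)
  have hHx' : x / 2 ≤ (H : ℝ) + 1 := by
    rw [hx, div_le_iff₀ (by norm_num : (0:ℝ) < 2)]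
    exact_mod_cast (show D ≤ (H + 1) * 2 by omega)
  set N : ℕ := (H + 1) * (H + 1) with hN
  clear_value x H L N
  have hN4 : x ^ 2 / 4 ≤ (N : ℝ) := by
    rw [hN]; push_cast
    have h2 : (x / 2) ^ 2 ≤ ((H : ℝ) + 1) ^ 2 := pow_le_pow_left₀ (by linarith) hHx' 2
    nlinarith [h2]
  have hNx : (N : ℝ) ≤ (x + 1) ^ 2 := by
    rw [hN]; push_cast
    have h2 : ((H : ℝ) + 1) ^ 2 ≤ (x + 1) ^ 2 := pow_le_pow_left₀ (by positivity) (by linarith) 2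
    nlinarith [h2]
  have hx24 : 24 * x ^ τ ≤ x ^ (2 : ℝ) := by simpa using e4
  have hx2 : x ^ (2 : ℝ) = x ^ 2 := Real.rpow_two x
  have hLN2 : 2 * (L : ℝ) ≤ N := by
    calc 2 * (L : ℝ) ≤ 6 * x ^ τ := by linarith
      _ ≤ x ^ 2 / 4 := by rw [← hx2]; linarith
      _ ≤ N := hN4
  have hLN : L < N := by
    have h2 : ((2 * L : ℕ) : ℝ) ≤ N := by push_cast; exact hLN2
    have h3 : 2 * L ≤ N := by exact_mod_cast h2
    omega
  -- Siegel (the sup norm on integer matrices, as in Mathlib's Siegel lemma, as a term-level instance)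
  letI instM : SeminormedAddCommGroup (Matrix (Fin L) (Fin (H + 1) × Fin (H + 1)) ℤ) :=
    Matrix.seminormedAddCommGroup
  obtain ⟨t, ht0, hAt, hnorm⟩ := Int.Matrix.exists_ne_zero_int_vec_norm_le (taylorMatrix L H H)
    (by rw [Fintype.card_fin, Fintype.card_prod, Fintype.card_fin, ← hN]; exact hLN)
    (by rw [Fintype.card_fin]; omega)
  refine ⟨t, ht0, fun n hn => ?_, ?_⟩
  · have := congrFun hAt ⟨n, hn⟩
    rwa [taylorMatrix_mulVec, Pi.zero_apply] at this
  · have hnorm' : ‖t‖ ≤ ((((H + 1) * (H + 1) : ℕ) : ℝ) * max 1 ‖taylorMatrix L H H‖) ^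
        ((L : ℝ) / ((((H + 1) * (H + 1) : ℕ) : ℝ) - L)) := by
      have h := hnorm
      rw [Fintype.card_fin, Fintype.card_prod, Fintype.card_fin] at h
      exact h
    refine hnorm'.trans ?_
    -- the base and the exponent
    have hA : ‖taylorMatrix L H H‖ ≤ (L : ℝ) ^ L * Real.exp H := norm_taylorMatrix_le L H H hL1
    have hmax : max 1 ‖taylorMatrix L H H‖ ≤ (L : ℝ) ^ L * Real.exp H := by
      refine max_le ?_ hA
      exact one_le_mul_of_one_le_of_one_le (one_le_pow₀ (by exact_mod_cast hL1))
        (Real.one_le_exp (by positivity))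
    have hmax1 : 1 ≤ max 1 ‖taylorMatrix L H H‖ := le_max_left _ _
    have hN1 : (1 : ℝ) ≤ (((H + 1) * (H + 1) : ℕ) : ℝ) := by
      exact_mod_cast Nat.one_le_iff_ne_zero.2 (by positivity)
    have hNcast : (((H + 1) * (H + 1) : ℕ) : ℝ) = N := by rw [hN]
    set B₀ : ℝ := (((H + 1) * (H + 1) : ℕ) : ℝ) * max 1 ‖taylorMatrix L H H‖ with hB₀
    have hB₀1 : 1 ≤ B₀ := one_le_mul_of_one_le_of_one_le hN1 hmax1
    have hB₀pos : 0 < B₀ := by linarith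
    have hlogx : 0 ≤ Real.log x := Real.log_nonneg hD1r
    have hlog3 : 0 ≤ Real.log 3 := Real.log_nonneg (by norm_num)
    have hLlogL : (L : ℝ) * Real.log L ≤ 3 * x ^ τ * (Real.log 3 + τ * Real.log x) := by
      have hlogL : Real.log L ≤ Real.log 3 + τ * Real.log x := by
        calc Real.log L ≤ Real.log (3 * x ^ τ) := Real.log_le_log hL0 hLx
          _ = Real.log 3 + τ * Real.log x := by
              rw [Real.log_mul (by norm_num) (by positivity), Real.log_rpow hD0r]
      calc (L : ℝ) * Real.log L ≤ L * (Real.log 3 + τ * Real.log x) :=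
            mul_le_mul_of_nonneg_left hlogL hL0.le
        _ ≤ 3 * x ^ τ * (Real.log 3 + τ * Real.log x) :=
            mul_le_mul_of_nonneg_right hLx (by positivity)
    have hlogB₀ : Real.log B₀ ≤ 2 * x + (3 * x ^ τ * (Real.log 3 + τ * Real.log x) + x / 2) := by
      have hlogN : Real.log (((H + 1) * (H + 1) : ℕ) : ℝ) ≤ 2 * x := by
        have h1 : Real.log (((H + 1) * (H + 1) : ℕ) : ℝ) ≤ Real.log ((x + 1) ^ 2) :=
          Real.log_le_log (by positivity) (by rw [hNcast]; exact hNx)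
        have h2 : Real.log (x + 1) ≤ x := by
          have := Real.log_le_sub_one_of_pos (show 0 < x + 1 by linarith); linarith
        have hlog2 : Real.log ((x + 1) ^ 2) = 2 * Real.log (x + 1) := by
          rw [Real.log_pow]; norm_num
        rw [hlog2] at h1; linarith
      have hlogmax : Real.log (max 1 ‖taylorMatrix L H H‖) ≤ L * Real.log L + H := by
        calc Real.log (max 1 ‖taylorMatrix L H H‖) ≤ Real.log ((L : ℝ) ^ L * Real.exp H) :=
              Real.log_le_log (by positivity) hmax
          _ = L * Real.log L + H := by
              rw [Real.log_mul (by positivity) (by positivity), Real.log_pow, Real.log_exp]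
      rw [hB₀, Real.log_mul (by positivity) (by positivity)]
      linarith
    have hlogB₀0 : 0 ≤ Real.log B₀ := Real.log_nonneg hB₀1
    have hexp_le : (L : ℝ) / ((((H + 1) * (H + 1) : ℕ) : ℝ) - L) ≤ 24 * x ^ (τ - 2) := by
      rw [hNcast]
      have hLhalf : (L : ℝ) ≤ N / 2 := by
        rw [le_div_iff₀ (two_pos : (0:ℝ) < 2), mul_comm]; exact hLN2
      have hNL : (N : ℝ) / 2 ≤ (N : ℝ) - L := by
        calc (N : ℝ) / 2 = N - N / 2 := by ring
          _ ≤ N - L := sub_le_sub_left hLhalf _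
      have hNpos' : (0 : ℝ) < N := lt_of_lt_of_le (by positivity) hN4
      have hNLpos : (0 : ℝ) < (N : ℝ) - L := lt_of_lt_of_le (half_pos hNpos') hNL
      have hNpos : (0 : ℝ) < x ^ 2 / 8 := by positivity
      have hx8 : x ^ 2 / 8 ≤ (N : ℝ) - L := by
        calc x ^ 2 / 8 = (x ^ 2 / 4) / 2 := by ring
          _ ≤ (N : ℝ) / 2 := by gcongr
          _ ≤ N - L := hNL
      calc (L : ℝ) / ((N : ℝ) - L) ≤ (3 * x ^ τ) / ((N : ℝ) - L) :=
            div_le_div_of_nonneg_right hLx hNLpos.le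
        _ ≤ (3 * x ^ τ) / (x ^ 2 / 8) :=
            div_le_div_of_nonneg_left (by positivity) hNpos hx8
        _ = 24 * (x ^ τ / x ^ 2) := by ring
        _ = 24 * x ^ (τ - 2) := by rw [← hx2, ← Real.rpow_sub hD0r]
    have hexp0 : 0 ≤ (L : ℝ) / ((((H + 1) * (H + 1) : ℕ) : ℝ) - L) := by
      rw [hNcast]
      have hLhalf : (L : ℝ) ≤ N / 2 := by
        rw [le_div_iff₀ (two_pos : (0:ℝ) < 2), mul_comm]; exact hLN2
      have hNpos' : (0 : ℝ) < N := lt_of_lt_of_le (by positivity) hN4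
      exact div_nonneg hL0.le (by
        have : (N : ℝ) / 2 ≤ N - L := by
          calc (N : ℝ) / 2 = N - N / 2 := by ring
            _ ≤ N - L := sub_le_sub_left hLhalf _
        exact (lt_of_lt_of_le (half_pos hNpos') this).le)
    -- x-power identities
    have hp1 : x ^ (τ - 2) * x = x ^ (τ - 1) := by
      rw [← Real.rpow_add_one hD0r.ne']; ring_nf
    have hp2 : x ^ (τ - 2) * x ^ τ = x ^ (2 * τ - 2) := by
      rw [← Real.rpow_add hD0r]; ring_nf
    have hxτ2 : 0 ≤ x ^ (τ - 2) := Real.rpow_nonneg hD0r.le _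
    -- assemble
    have hprod : Real.log B₀ * ((L : ℝ) / ((((H + 1) * (H + 1) : ℕ) : ℝ) - L)) ≤ x ^ β / 2 := by
      calc Real.log B₀ * ((L : ℝ) / ((((H + 1) * (H + 1) : ℕ) : ℝ) - L))
          ≤ (2 * x + (3 * x ^ τ * (Real.log 3 + τ * Real.log x) + x / 2)) * (24 * x ^ (τ - 2)) :=
            mul_le_mul hlogB₀ hexp_le hexp0 (by positivity)
        _ = 60 * (x ^ (τ - 2) * x) + 72 * Real.log 3 * (x ^ (τ - 2) * x ^ τ) +
              72 * τ * (x ^ (τ - 2) * x ^ τ) * Real.log x := by ring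
        _ = 60 * x ^ (τ - 1) + 72 * Real.log 3 * x ^ (2 * τ - 2) +
              72 * τ * x ^ (2 * τ - 2) * Real.log x := by rw [hp1, hp2]
        _ ≤ 1 / 6 * x ^ β + 1 / 6 * x ^ β + 1 / 6 * x ^ β := by linarith only [e1, e2, e3]
        _ = x ^ β / 2 := by ring
    rw [Real.rpow_def_of_pos hB₀pos]
    exact Real.exp_le_exp.2 hprod

/-- **Thue–Siegel NON-VACUITY at `(0, p/q)`**: for integers `p, q ≠ 0`, `0 ≤ τ < 2`,
`β > max{τ − 1, 2τ − 2}`, `β > 1` (to absorb the rescaling), and EVERY `ν`, the small-value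
hypothesis of the crux holds at the algebraic point `(0, p/q)` with EXACT zeros.
[cite: Roy2013, p. 3 (Thue–Siegel)] -/
theorem hyp_at_zero_rat (p q : ℤ) (hp : p ≠ 0) (hq : q ≠ 0) {τ β : ℝ} (hτ0 : 0 ≤ τ) (hτ2 : τ < 2)
    (hβ2 : 2 * τ - 2 < β) (hβ1 : 1 < β) (ν : ℝ) :
    ∀ᶠ D : ℕ in atTop, ∃ P : MvPolynomial (Fin 2) ℤ, P ≠ 0 ∧ P.totalDegree ≤ D ∧
      (mvPolyHeight P : ℝ) ≤ Real.exp ((D : ℝ) ^ β) ∧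
      ∀ i : ℕ, i < 3 * ⌊(D : ℝ) ^ τ⌋₊ →
        ‖aeval ![(0 : ℂ), (p : ℂ) / (q : ℂ)] (royD^[i] P)‖ ≤ Real.exp (-(D : ℝ) ^ ν) := by
  set R : ℝ := max |(p : ℝ)| |(q : ℝ)| with hR
  have hR1 : 1 ≤ R := by
    have : (1 : ℝ) ≤ |(p : ℝ)| := by
      have h := Int.one_le_abs hp
      exact_mod_cast h
    exact this.trans (le_max_left _ _)
  have hlogR : 0 ≤ Real.log R := Real.log_nonneg hR1
  have hev := (exists_taylor_kernel hτ0 hτ2 (by linarith) hβ2).and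
    (eventually_nat_rpow_le (Real.log R / 2) hβ1 (show (0:ℝ) < 1 / 2 by norm_num))
  filter_upwards [hev, eventually_ge_atTop 1] with D hD hD1
  obtain ⟨⟨t, ht0, hker, hnorm⟩, e1⟩ := hD
  have hD0r : (0 : ℝ) < D := by exact_mod_cast hD1
  refine ⟨polyOfCoeffs fun ab => t ab * p ^ (D / 2 - (ab.2 : ℕ)) * q ^ (ab.2 : ℕ),
    polyOfCoeffs_ne_zero (rescaled_ne_zero ht0 hp hq), ?_, ?_, fun i hi => ?_⟩
  · exact (totalDegree_polyOfCoeffs_le _).trans (by omega)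
  · refine (mvPolyHeight_polyOfCoeffs_le _).trans ((norm_rescaled_le t p q).trans ?_)
    have hH : ((D / 2 : ℕ) : ℝ) ≤ (D : ℝ) / 2 := by
      rw [le_div_iff₀ (by norm_num : (0:ℝ) < 2)]; exact_mod_cast (show D / 2 * 2 ≤ D by omega)
    have hRH : R ^ (D / 2) ≤ Real.exp ((D : ℝ) ^ β / 2) := by
      rw [← Real.rpow_natCast, Real.rpow_def_of_pos (by linarith)]
      refine Real.exp_le_exp.2 ?_
      calc Real.log R * ((D / 2 : ℕ) : ℝ) ≤ Real.log R * (D / 2) := mul_le_mul_of_nonneg_left hH hlogR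
        _ = Real.log R / 2 * (D : ℝ) ^ (1 : ℝ) := by rw [Real.rpow_one]; ring
        _ ≤ 1 / 2 * (D : ℝ) ^ β := e1
        _ = (D : ℝ) ^ β / 2 := by ring
    calc ‖t‖ * R ^ (D / 2) ≤ Real.exp ((D : ℝ) ^ β / 2) * Real.exp ((D : ℝ) ^ β / 2) :=
          mul_le_mul hnorm hRH (by positivity) (by positivity)
      _ = Real.exp ((D : ℝ) ^ β) := by rw [← Real.exp_add]; ring_nf
  · rw [aeval_rescaled t p q hq, hker i hi]
    simp [(Real.exp_pos _).le]

end Summit.Schanuel.Schanuel.Theorems.RoySmallValueDirichletGapThueSiegel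

end
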